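import Summits.ResolutionOfSingularities.ResolutionOfSingularities.Theorems.PurelyInseparableDim4ChartAtlasSNCFarChart
import Summits.ResolutionOfSingularities.ResolutionOfSingularities.Theorems.PurelyInseparableDim4ChartAtlasSNCJacobianIndexed
import HarnessLib

/-!
# Purely inseparable four-folds `z^p + F(x₁, …, x₄)`: the far good chart WITH PARALLEL MEMBERS — hyperplanes and far quadrics indexed by PAIRS
# (index, constant), several members per index allowed (S3-N2 positive side; cell `res-dim4-pi`, typ-2 g6)

[OURS · counted 0] (D-0157 DOOR 2; DR-157-C; typ-2 g5/g6 HANDOFF OPEN item «parallel members of equal index»). p701847's far good chart keys the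
quadrics by their index (`fs`, one constant `dᵢ` per index). This file re-proves it with the quadrics keyed by PAIRS `(i, d) ∈ FQ` —
`Q_{i,d} = ((yᵢ + bᵢ)·y_j + d)·𝒪`, several PARALLEL far members `{xᵢ = -d}, {xᵢ = -d'}` of one index allowed (they never meet) — and, as before,
hyperplanes keyed by any finite set of pairs. PROVED here (no `sorry`, no new axiom), over the INDEXED engine p707152 (no shape lemmas):

* `hasSNCWith_𝓘Λ_hyperplanes_pairs` — translated hyperplanes `(y_m + a)·𝒪`, `(m, a)` in ANY finite set, are snc with every coordinate centre
  `V(y_Λ)` (the pair form of p686?/g2's `hasSNCWith_translatedHyperplanes_𝓘Λ`, parallel members included);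
* **`hasSNCWith_𝓘Λ_of_forall_mem_far_pairs`** — chart `j`, escaping case `j ∉ T`: hyperplanes `(m, a) ∈ H`, quadrics `(i, d) ∈ FQ` (`i ≠ j`,
  `d ≠ 0`) with (C1) `(i⁺, a) ∈ H → a = bᵢ`, (C2) `a·bᵢ ≠ d` for `(j⁺, a) ∈ H`, `i ∈ T`, `bᵢ ≠ 0`, (C3) `d·b_k ≠ d'·bᵢ` for distinct ACTIVE pairs
  `(i, d), (k, d')` (`i, k ∈ T`, `bᵢ, b_k ≠ 0`) ⟹ `HasSNCWith E (𝓘Λ 4 K ({0} ∪ T⁺))`.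

Nothing here is a statement about resolution of singularities in dimension ≥ 4 / characteristic `p` (NOT proved anywhere in this programme).
bears_on: LADDER-RESOLUTION:D157-DOOR2 (res-dim4-pi). Supports stmt-ResolutionOfSingularities-16155 (helper, S3-N2 positive side, parallel members).
-/

-- every declaration of this summit lives under `Summit.ResolutionOfSingularities.ResolutionOfSingularities`
-- (summit = problem), which the duplicate-namespace linter flags; house convention (cf. the Target file).
set_option linter.dupNamespace false

noncomputable section

open MvPolynomial CategoryTheory AlgebraicGeometry Opposite TopologicalSpace
open AlgebraicGeometry.Scheme.IdealSheafData (ofIdealTop)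

namespace Summit.ResolutionOfSingularities.ResolutionOfSingularities.Theorems.PIDim4

open Literature.AlgebraicGeometry.Resolution
open Literature.AlgebraicGeometry.Resolution.AffinePointBlowup (P A γ coord Wtop ξ)

namespace ChartDictionary

variable {K : Type} [Field K]

/-- A finite set `G` of pairs `(m, 0)`, `m ∈ Λ`, presents the coordinate centre: `span {y_m + 0 : (m, 0) ∈ G} = (y_Λ)`. -/
theorem span_image_X_add_C_eq_of_pairs (Λ : Set (Fin (4 + 1))) (G : Finset (Fin (4 + 1) × K)) (hG : ∀ a, a ∈ G ↔ ∃ m ∈ Λ, a = (m, 0)) :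
    Ideal.span ((fun ma : Fin (4 + 1) × K => (X ma.1 + C ma.2 : A 4 K)) '' (G : Set (Fin (4 + 1) × K))) = Ideal.span (X '' Λ) := by
  congr 1
  ext q
  constructor
  · rintro ⟨a, ha, rfl⟩
    obtain ⟨m, hm, rfl⟩ := (hG a).mp (Finset.mem_coe.mp ha)
    exact ⟨m, hm, by change X m = X m + C 0; rw [C_0, add_zero]⟩
  · rintro ⟨m, hm, rfl⟩
    exact ⟨(m, 0), Finset.mem_coe.mpr ((hG _).mpr ⟨m, hm, rfl⟩), by change X m + C 0 = X m; rw [C_0, add_zero]⟩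

/-- **TRANSLATED HYPERPLANES INDEXED BY PAIRS ARE SNC WITH EVERY COORDINATE CENTRE** (parallel members of one index included: they never meet). -/
theorem hasSNCWith_𝓘Λ_hyperplanes_pairs (Λ : Set (Fin (4 + 1))) (H : Finset (Fin (4 + 1) × K)) {E : List (Scheme.IdealSheafData (P 4 K))}
    (hE : ∀ D ∈ E, D = ⊤ ∨ ∃ ma ∈ H, D = ofIdealTop (Ideal.span {(γ 4 K).symm (X ma.1 + C ma.2)})) :
    HasSNCWith E (AffineCoordBlowup.𝓘Λ 4 K Λ) := by
  classical
  let G : Finset (Fin (4 + 1) × K) := (Set.toFinite Λ).toFinset.image fun m => (m, (0 : K))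
  have hG : ∀ a, a ∈ G ↔ ∃ m ∈ Λ, a = (m, 0) := by
    intro a
    simp only [G, Finset.mem_image, Set.Finite.mem_toFinset]
    exact ⟨fun ⟨m, hm, h⟩ => ⟨m, hm, h.symm⟩, fun ⟨m, hm, h⟩ => ⟨m, hm, h.symm⟩⟩
  let f : Fin (4 + 1) × K → A 4 K := fun ma => X ma.1 + C ma.2
  have hf𝔭 : ∀ (x : P 4 K) (ma : Fin (4 + 1) × K), (ma ∈ H ∧ f ma ∈ x.asIdeal ∨ ma ∈ G ∧ ∀ g ∈ G, f g ∈ x.asIdeal) → f ma ∈ x.asIdeal := by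
    rintro x ma (⟨-, h⟩ | ⟨hma, h⟩)
    · exact h
    · exact h ma hma
  refine hasSNCWith_𝓘Λ_of_jacobian_indexed E Λ H G f (span_image_X_add_C_eq_of_pairs Λ G hG) hE (fun _ _ => 0) (fun _ ma => ma.1) ?_ ?_
  · intro x ma _
    change pderiv ma.1 (X ma.1 + C ma.2 : A 4 K) ∉ x.asIdeal
    rw [pderiv_X_add_C, if_pos rfl]
    exact fun h1 => x.2.ne_top ((Ideal.eq_top_iff_one _).mpr h1)
  · intro x ma ma' hma hma' hne _
    change pderiv ma'.1 (X ma.1 + C ma.2 : A 4 K) ∈ x.asIdeal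
    rw [pderiv_X_add_C]
    by_cases hmm : ma'.1 = ma.1
    · exfalso
      have h2 := X_add_C_eq_of_mem_of_mem x (k := ma.1) (a := ma.2) (a' := ma'.2) (hf𝔭 x ma hma) (by rw [← hmm]; exact hf𝔭 x ma' hma')
      exact hne (Prod.ext hmm.symm h2)
    · rw [if_neg hmm]; exact x.asIdeal.zero_mem

variable {T : Finset (Fin 4)} {j : Fin 4} {b : Fin 4 → K}

/-- **THE FAR GOOD CHART WITH PARALLEL MEMBERS (`x_j`-chart, escaping case `j ∉ T`).** Hyperplanes `(y_m + a)·𝒪`, `(m, a) ∈ H`; far quadrics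
`Q_{i,d} = ((yᵢ + bᵢ)·y_j + d)·𝒪`, `(i, d) ∈ FQ`, `i ≠ j`, `d ≠ 0`; (C1) a hyperplane of a quadric's index has constant `bᵢ`; (C2) no index-`j` hyperplane at
an active quadric's height (`a·bᵢ ≠ d` for `i ∈ T`, `bᵢ ≠ 0`); (C3) no two distinct active pairs share a height (`d·b_k ≠ d'·bᵢ`). Then
`HasSNCWith E (𝓘Λ 4 K ({0} ∪ T⁺))`. -/
theorem hasSNCWith_𝓘Λ_of_forall_mem_far_pairs (hjT : j ∉ T) (H : Finset (Fin (4 + 1) × K)) (FQ : Finset (Fin 4 × K))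
    (hFQ : ∀ id ∈ FQ, id.1 ≠ j ∧ id.2 ≠ 0) (hC1 : ∀ id ∈ FQ, ∀ a : K, (id.1.succ, a) ∈ H → a = b id.1)
    (hC2 : ∀ id ∈ FQ, id.1 ∈ T → b id.1 ≠ 0 → ∀ a : K, (j.succ, a) ∈ H → a * b id.1 ≠ id.2)
    (hC3 : ∀ id ∈ FQ, ∀ kd ∈ FQ, id ≠ kd → id.1 ∈ T → kd.1 ∈ T → b id.1 ≠ 0 → b kd.1 ≠ 0 → id.2 * b kd.1 ≠ kd.2 * b id.1)
    {E : List (Scheme.IdealSheafData (P 4 K))}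
    (hE : ∀ D ∈ E, D = ⊤ ∨ (∃ ma ∈ H, D = ofIdealTop (Ideal.span {(γ 4 K).symm (X ma.1 + C ma.2)})) ∨
      ∃ id ∈ FQ, D = ofIdealTop (Ideal.span {(γ 4 K).symm ((X id.1.succ + C (b id.1)) * X j.succ + C id.2)})) :
    HasSNCWith E (AffineCoordBlowup.𝓘Λ 4 K (insert 0 (Fin.succ '' (T : Set (Fin 4))))) := by
  classical
  set Λ : Set (Fin (4 + 1)) := insert 0 (Fin.succ '' (T : Set (Fin 4))) with hΛ
  have hmemΛ : ∀ i : Fin 4, i.succ ∈ Λ ↔ i ∈ T := fun i => succ_mem_centreVars_iff T i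
  have hjΛ : j.succ ∉ Λ := fun h => hjT ((hmemΛ j).mp h)
  let G : Finset ((Fin (4 + 1) × K) ⊕ (Fin 4 × K)) := ((Set.toFinite Λ).toFinset.image fun m => (m, (0 : K))).image Sum.inl
  let f : (Fin (4 + 1) × K) ⊕ (Fin 4 × K) → A 4 K :=
    Sum.elim (fun ma => X ma.1 + C ma.2) (fun id => (X id.1.succ + C (b id.1)) * X j.succ + C id.2)
  have hGmem : ∀ a, a ∈ G ↔ ∃ m ∈ Λ, a = Sum.inl (m, 0) := by
    intro a
    simp only [G, Finset.mem_image, Set.Finite.mem_toFinset]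
    constructor
    · rintro ⟨_, ⟨m, hm, rfl⟩, rfl⟩; exact ⟨m, hm, rfl⟩
    · rintro ⟨m, hm, rfl⟩; exact ⟨(m, 0), ⟨m, hm, rfl⟩, rfl⟩
  have hspan : Ideal.span (f '' (G : Set _)) = Ideal.span (X '' Λ) := by
    congr 1
    ext q
    constructor
    · rintro ⟨a, ha, rfl⟩
      obtain ⟨m, hm, rfl⟩ := (hGmem a).mp (Finset.mem_coe.mp ha)
      exact ⟨m, hm, by change X m = X m + C 0; rw [C_0, add_zero]⟩
    · rintro ⟨m, hm, rfl⟩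
      exact ⟨Sum.inl (m, 0), Finset.mem_coe.mpr ((hGmem _).mpr ⟨m, hm, rfl⟩), by change X m + C 0 = X m; rw [C_0, add_zero]⟩
  -- activity of a quadric at a point: its private variable is a centre variable and the centre passes
  let act : P 4 K → Fin 4 → Prop := fun x i => i.succ ∈ Λ ∧ ∀ m ∈ Λ, (X m : A 4 K) ∈ x.asIdeal
  let v : P 4 K → (Fin (4 + 1) × K) ⊕ (Fin 4 × K) → Fin (4 + 1) := fun x =>
    Sum.elim (fun ma => ma.1) (fun id => if act x id.1 then j.succ else id.1.succ)
  let ρ : P 4 K → (Fin (4 + 1) × K) ⊕ (Fin 4 × K) → ℕ := fun x =>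
    Sum.elim (fun _ => 0) (fun id => if act x id.1 then 1 else 2)
  have hfamily : ∀ (x : P 4 K) a, (a ∈ H.disjSum FQ ∧ f a ∈ x.asIdeal ∨ a ∈ G ∧ ∀ g ∈ G, f g ∈ x.asIdeal) → f a ∈ x.asIdeal ∧
      ((∃ ma, a = Sum.inl ma ∧ (ma ∈ H ∨ ma.2 = 0 ∧ ma.1 ∈ Λ ∧ ∀ m ∈ Λ, (X m : A 4 K) ∈ x.asIdeal)) ∨ ∃ id ∈ FQ, a = Sum.inr id) := by
    rintro x a (⟨haI, ha𝔭⟩ | ⟨haG, hall⟩)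
    · refine ⟨ha𝔭, ?_⟩
      rcases Finset.mem_disjSum.mp haI with ⟨ma, hma, rfl⟩ | ⟨id, hid, rfl⟩
      · exact Or.inl ⟨ma, rfl, Or.inl hma⟩
      · exact Or.inr ⟨id, hid, rfl⟩
    · obtain ⟨m, hm, rfl⟩ := (hGmem a).mp haG
      have hallΛ : ∀ m ∈ Λ, (X m : A 4 K) ∈ x.asIdeal := fun m' hm' => by
        have h := hall _ ((hGmem _).mpr ⟨m', hm', rfl⟩)
        change (X m' + C 0 : A 4 K) ∈ x.asIdeal at h
        rwa [C_0, add_zero] at h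
      exact ⟨hall _ haG, Or.inl ⟨(m, 0), rfl, Or.inr ⟨rfl, hm, hallΛ⟩⟩⟩
  refine hasSNCWith_𝓘Λ_of_jacobian_indexed E Λ (H.disjSum FQ) G f hspan ?_ ρ v ?_ ?_
  · intro D hD
    rcases hE D hD with h | ⟨ma, hma, h⟩ | ⟨id, hid, h⟩
    · exact Or.inl h
    · exact Or.inr ⟨Sum.inl ma, Finset.inl_mem_disjSum.mpr hma, h⟩
    · exact Or.inr ⟨Sum.inr id, Finset.inr_mem_disjSum.mpr hid, h⟩
  · -- diagonal
    intro x a ha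
    obtain ⟨ha𝔭, hshape⟩ := hfamily x a ha
    rcases hshape with ⟨ma, rfl, -⟩ | ⟨id, hid, rfl⟩
    · change pderiv ma.1 (X ma.1 + C ma.2 : A 4 K) ∉ x.asIdeal
      rw [pderiv_X_add_C, if_pos rfl]
      exact fun h1 => x.2.ne_top ((Ideal.eq_top_iff_one _).mpr h1)
    · obtain ⟨hij, hd⟩ := hFQ id hid
      change pderiv (if act x id.1 then j.succ else id.1.succ) ((X id.1.succ + C (b id.1)) * X j.succ + C id.2 : A 4 K) ∉ x.asIdeal
      by_cases hact : act x id.1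
      · rw [if_pos hact, pderiv_quadric_j (d := fun _ => id.2) hij]
        exact X_add_C_not_mem_of_quadric_mem x (d := fun _ => id.2) hd ha𝔭
      · rw [if_neg hact, pderiv_quadric_self (d := fun _ => id.2) hij]
        exact X_j_not_mem_of_quadric_mem x (d := fun _ => id.2) hd ha𝔭
  · -- triangularity
    intro x a a' ha ha' hne hρle
    obtain ⟨ha𝔭, hshape⟩ := hfamily x a ha
    obtain ⟨ha'𝔭, hshape'⟩ := hfamily x a' ha'
    rcases hshape with ⟨ma, rfl, hma⟩ | ⟨id, hid, rfl⟩
    · change pderiv (v x a') (X ma.1 + C ma.2 : A 4 K) ∈ x.asIdeal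
      rw [pderiv_X_add_C]
      split_ifs with ho
      swap
      · exact x.asIdeal.zero_mem
      exfalso
      rcases hshape' with ⟨ma', rfl, -⟩ | ⟨id', hid', rfl⟩
      · change ma'.1 = ma.1 at ho
        have h2 := X_add_C_eq_of_mem_of_mem x (k := ma.1) (a := ma.2) (a' := ma'.2) ha𝔭 (by rw [← ho]; exact ha'𝔭)
        exact hne (by rw [show ma = ma' from Prod.ext ho.symm h2])
      · obtain ⟨hij', hd'⟩ := hFQ id' hid'
        change (if act x id'.1 then j.succ else id'.1.succ) = ma.1 at ho
        by_cases hact : act x id'.1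
        · rw [if_pos hact] at ho
          -- an index-`j` hyperplane at an active quadric's height
          have hmaH : ma ∈ H := by
            rcases hma with h | ⟨-, h, -⟩
            · exact h
            · exact absurd (ho ▸ h) hjΛ
          have hXi : (X id'.1.succ : A 4 K) ∈ x.asIdeal := hact.2 _ hact.1
          have hbi : b id'.1 ≠ 0 := (C_mul_X_add_C_mem_of_quadric_mem x (d := fun _ => id'.2) hd' ha'𝔭 hXi).2
          have hq : (X j.succ + C ma.2 : A 4 K) ∈ x.asIdeal := by rw [ho]; exact ha𝔭
          exact hC2 id' hid' ((hmemΛ _).mp hact.1) hbi ma.2 (by rw [ho]; exact hmaH)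
            (height_eq_of_X_add_C_mem x (d := fun _ => id'.2) hd' ha'𝔭 hXi hq)
        · rw [if_neg hact] at ho
          rcases hma with h | ⟨h0, hmem, hall⟩
          · have hb := hC1 id' hid' ma.2 (by rw [ho]; exact h)
            exact X_add_C_not_mem_of_quadric_mem x (d := fun _ => id'.2) hd' ha'𝔭 (by rw [ho, ← hb]; exact ha𝔭)
          · exact hact ⟨ho ▸ hmem, hall⟩
    · obtain ⟨hij, hd⟩ := hFQ id hid
      rcases hshape' with ⟨ma', rfl, -⟩ | ⟨id', hid', rfl⟩
      · exfalso
        change (if act x id.1 then 1 else 2) ≤ 0 at hρle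
        split_ifs at hρle <;> omega
      · obtain ⟨hij', hd'⟩ := hFQ id' hid'
        change pderiv (if act x id'.1 then j.succ else id'.1.succ) ((X id.1.succ + C (b id.1)) * X j.succ + C id.2 : A 4 K) ∈ x.asIdeal
        by_cases hact' : act x id'.1
        · -- `a'` active of rank 1 ≥ rank `a`: `a` active too, equal heights
          exfalso
          have hact : act x id.1 := by
            change (if act x id.1 then 1 else 2) ≤ (if act x id'.1 then 1 else 2) at hρle
            by_contra h; rw [if_neg h, if_pos hact'] at hρle; omega
          have hXi : (X id.1.succ : A 4 K) ∈ x.asIdeal := hact.2 _ hact.1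
          have hXi' : (X id'.1.succ : A 4 K) ∈ x.asIdeal := hact'.2 _ hact'.1
          obtain ⟨hi, hbi⟩ := C_mul_X_add_C_mem_of_quadric_mem x (d := fun _ => id.2) hd ha𝔭 hXi
          obtain ⟨hi', hbi'⟩ := C_mul_X_add_C_mem_of_quadric_mem x (d := fun _ => id'.2) hd' ha'𝔭 hXi'
          refine hC3 id hid id' hid' (fun h => hne (by rw [h])) ((hmemΛ _).mp hact.1) ((hmemΛ _).mp hact'.1) hbi hbi' ?_
          · have h1 := x.asIdeal.sub_mem (x.asIdeal.mul_mem_left (C (b id'.1)) hi) (x.asIdeal.mul_mem_left (C (b id.1)) hi')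
            have e1 : (C (b id'.1) * (C (b id.1) * X j.succ + C id.2) - C (b id.1) * (C (b id'.1) * X j.succ + C id'.2) : A 4 K) =
                C (id.2 * b id'.1 - id'.2 * b id.1) := by
              simp only [C_sub, C_mul]; ring
            rw [e1, C_mem_asIdeal_iff, sub_eq_zero] at h1
            exact h1
        · rw [if_neg hact']
          by_cases hii : id'.1 = id.1
          · -- the same index: parallel quadrics never meet, so this is the same pair
            exfalso
            have h1 : ((X id.1.succ + C (b id.1)) * X j.succ + C id.2 - ((X id'.1.succ + C (b id'.1)) * X j.succ + C id'.2) : A 4 K) ∈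
                x.asIdeal := x.asIdeal.sub_mem ha𝔭 ha'𝔭
            have e1 : ((X id.1.succ + C (b id.1)) * X j.succ + C id.2 - ((X id'.1.succ + C (b id'.1)) * X j.succ + C id'.2) : A 4 K) =
                C (id.2 - id'.2) := by rw [hii, C_sub]; ring
            rw [e1, C_mem_asIdeal_iff, sub_eq_zero] at h1
            exact hne (by rw [show id = id' from Prod.ext hii.symm h1])
          · rw [pderiv_quadric_of_ne (d := fun _ => id.2) (fun h => hii (Fin.succ_injective _ h)) (fun h => hij' (Fin.succ_injective _ h))]
            exact x.asIdeal.zero_mem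

end ChartDictionary

end Summit.ResolutionOfSingularities.ResolutionOfSingularities.Theorems.PIDim4

end
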